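import Summits.Langlands.Langlands.Theorems.QuarterDeficit1951CorrespondentFingerprintComposition
import Summits.Langlands.Langlands.Theorems.QuarterDeficit1951CorrespondentFingerprintStubLevelOneLocal1951
import Summits.Langlands.Langlands.Theorems.QuarterDeficit1951CorrespondentFingerprintStubDescent

/-!
# Crux `QuarterDeficit1951.CorrespondentFingerprint` (stmt-Langlands-15898) — line `Sketch`, closing file

`CorrespondentFingerprint_proof`: the route decl BY NAME, from the landed composition
`stub_composition` (the crux modulo its two last stubs) applied to the landed `stub_levelOne_local1951`
(LevelExactness at `1951`) and `stub_descent` (the weight-`0` Maass descent).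
-/

set_option linter.dupNamespace false

namespace Summit.Langlands.Langlands.Theorems.CorrespondentFingerprint

/-- **`CorrespondentFingerprint`** (item stmt-Langlands-15898): an L-algebraic cuspidal correspondent
(all-places `Corresponds`) of an irreducible, finite-image, even `ρ : Γ_ℚ → GL₂(ℚ̄_ℓ)` of Artin conductor
`1951` with order-`5` determinant and icosahedral Frobenius data descends to a non-zero weight-`0` Maass
cusp form on `(Γ₀(1951), χ)`, `χ` of order `5`, `λ = 1/4`, `T_p`-eigen (`p ≤ 13`) with fingerprint in
`Φ = {0, 1, 4, (3 ± √5)/2}`. [folklore] -/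
theorem CorrespondentFingerprint_proof :
    Summit.Langlands.Langlands.Theses.QuarterDeficit1951.CorrespondentFingerprint :=
  stub_composition stub_levelOne_local1951 stub_descent

end Summit.Langlands.Langlands.Theorems.CorrespondentFingerprint
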